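import Summits.AtomisticToContinuum.Crystallization.Theorems.OverbindingBudgetAffineCushionCutA

/-!
# NODE 76 «CushionCut» (lens-4 g76) beneath 75P — part 2 of 2 (sequel of `…OverbindingBudgetAffineCushionCutA`)

Split for the 400-line cap by the landing lane (hand-2 g35); the module docstring of part 1 (`…OverbindingBudgetAffineCushionCutA`) describes the whole node.  Same namespace; all FQNs unchanged.
0 sorry; standard axioms.
-/


namespace Summit.AtomisticToContinuum.Crystallization.Theorems.OverbindingBudgetAffineCushionCut

open scoped BigOperators Classical
open Literature.MathematicalPhysics.StatisticalMechanics
open Literature.Geometry.DiscreteGeometry (IsChargeFree nearestDist nearestDist_nonneg nearestDist_le_dist fccTwoShellPattern hcpTwoShellPattern)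
open Summit.AtomisticToContinuum.Crystallization.Theorems.OverbindingBudgetMisfitCensusStatements (card_le_of_cube)
open Summit.AtomisticToContinuum.Crystallization.Theorems.OverbindingBudgetMisfitRegistration (Framed Reg DeepReg)
open Summit.AtomisticToContinuum.Crystallization.Theorems.OverbindingBudgetMisfitWindowStatements (InWindow offCount)
open Summit.AtomisticToContinuum.Crystallization.Theorems.OverbindingBudgetBalancedCensusStatements
open Summit.AtomisticToContinuum.Crystallization.Theorems.OverbindingBudgetHarmonicNormalForm (convexComb_core)
open Summit.AtomisticToContinuum.Crystallization.Theorems.OverbindingBudgetAffineLadder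
open Summit.AtomisticToContinuum.Crystallization.Theorems.OverbindingBudgetAffineMesoCut
open Summit.AtomisticToContinuum.Crystallization.Theorems.OverbindingBudgetAffinePhaseCut

variable {N : ℕ}

local notation "E3" => EuclideanSpace ℝ (Fin 3)

/-! ## §4  THE SEAMS (PROVED): KF ⇒ QC, HI ⇒ PM, FF ⇒ KF, KF ∧ HI ⇒ HD, the depth normal form of HD, HD ⇒ KF, HD ⇒ HI -/

/-- **KF_W ⇒ QC_W** (same frame, any window): QC prices a subset (`#fccRough ≤ #fccBall`) and rebates a superset (`#¬deep ≤ #¬deep + #mixedRough`);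
g75's `balancedW_mono_core` BY NAME. [this file] -/
theorem balancedFccRoughGapW_of_fccBallGapW {ρ ρ₁ ε₁ θ ε g r σ₁ σ₂ : ℝ} (h : BalancedFccBallGapW ρ ε g r σ₁ σ₂) :
    BalancedFccRoughGapW ρ ρ₁ ε₁ θ ε g r σ₁ σ₂ := by
  obtain ⟨c, C, hc, h⟩ := h
  refine ⟨c, max C 0, hc, fun N y hy => ?_⟩
  obtain ⟨u, hu, e⟩ := h N y hy
  refine ⟨u, hu, ?_⟩
  have hR : (fccRoughCount ρ ρ₁ ε₁ θ ε g r y : ℝ) ≤ fccBallCount ρ ε g r y := by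
    exact_mod_cast fccRoughCount_le_fccBallCount y
  have hX : (notDeepCount ρ ε g y : ℝ) ≤ ((notDeepCount ρ ε g y + mixedRoughCount ρ ρ₁ ε₁ θ ε g r y : ℕ) : ℝ) := by
    push_cast
    linarith [(Nat.cast_nonneg _ : (0 : ℝ) ≤ mixedRoughCount ρ ρ₁ ε₁ θ ε g r y)]
  exact balancedW_mono_core e hc.le hR hX (Nat.cast_nonneg _) (Nat.cast_nonneg _) (Real.rpow_nonneg (Nat.cast_nonneg _) _)
    (add_nonneg (dilGain_nonneg y) (shGain_nonneg _ y))

/-- **KF ⇒ QC** (tame). [this file] -/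
theorem tameBalancedFccRoughGap_of_fccBallGap {ρ ρ₁ ε₁ θ ε g r : ℝ} (h : TameBalancedFccBallGap ρ ε g r) :
    TameBalancedFccRoughGap ρ ρ₁ ε₁ θ ε g r :=
  fun δ hδ hδ2 => balancedFccRoughGapW_of_fccBallGapW (h δ hδ hδ2)

/-- **HI_W ⇒ PM_W** on a window `0 < σ₁ ≤ σ₂`, `0 ≤ r`: pricing the interface cubic letters prices the two-letter-ball rough sites at `c/(K+1)`,
`K = 27(2rσ₂+σ₁)³/σ₁³` (`mixedRoughCount_le_interfaceCubicCount`; same rebate). [this file] -/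
theorem balancedMixedRoughGapW_of_interfaceCubicGapW {ρ ρ₁ ε₁ θ ε g r σ₁ σ₂ : ℝ} (hr0 : 0 ≤ r) (hσ : 0 < σ₁) (hσσ : σ₁ ≤ σ₂)
    (h : BalancedInterfaceCubicGapW ρ ε g r σ₁ σ₂) : BalancedMixedRoughGapW ρ ρ₁ ε₁ θ ε g r σ₁ σ₂ := by
  obtain ⟨c, C, hc, h⟩ := h
  set K : ℝ := 27 / σ₁ ^ 3 * (2 * r * σ₂ + σ₁) ^ 3 with hK
  have hb : 0 ≤ 2 * r * σ₂ + σ₁ := by nlinarith [mul_nonneg hr0 (hσ.le.trans hσσ)]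
  have hK0 : 0 ≤ K := by rw [hK]; exact mul_nonneg (div_nonneg (by norm_num) (pow_nonneg hσ.le 3)) (pow_nonneg hb 3)
  have hK1 : 0 < K + 1 := by linarith
  set P : ℝ := max C 0 with hP
  have hP0 : 0 ≤ P := le_max_right _ _
  have hCP : C ≤ P := le_max_left _ _
  set c' : ℝ := c / (K + 1) with hc'
  have hc'0 : 0 < c' := by rw [hc']; positivity
  have hc'c : c' * K ≤ c := by
    rw [hc', div_mul_eq_mul_div, div_le_iff₀ hK1]
    nlinarith
  refine ⟨c', P + c', hc'0, fun N y hy => ?_⟩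
  obtain ⟨u, hu, e⟩ := h N y hy
  refine ⟨u, hu, ?_⟩
  have ha : (mixedRoughCount ρ ρ₁ ε₁ θ ε g r y : ℝ) ≤ K * interfaceCubicCount ρ ε g r y + offCount σ₁ σ₂ y := by
    rw [hK]; exact mixedRoughCount_le_interfaceCubicCount hr0 hσ hσσ hy
  have n1 : (0 : ℝ) ≤ interfaceCubicCount ρ ε g r y := Nat.cast_nonneg _
  have n3 : (0 : ℝ) ≤ notDeepCount ρ ε g y := Nat.cast_nonneg _
  have n5 : (0 : ℝ) ≤ offCount σ₁ σ₂ y := Nat.cast_nonneg _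
  have n6 : (0 : ℝ) ≤ (N : ℝ) ^ (2 / 3 : ℝ) := Real.rpow_nonneg (Nat.cast_nonneg _) _
  have g1 : 0 ≤ dilGain y + shGain u y := add_nonneg (dilGain_nonneg y) (shGain_nonneg _ y)
  have e' : (N : ℝ) * (⨅ Q : PeriodicConfiguration 3, Q.energyPerParticle lennardJones) + c * (interfaceCubicCount ρ ε g r y : ℝ)
      - P * (notDeepCount ρ ε g y : ℝ) - P * (offCount σ₁ σ₂ y : ℝ) - P * (N : ℝ) ^ (2 / 3 : ℝ) - P * (dilGain y + shGain u y)
      ≤ interactionEnergy lennardJones y := by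
    linarith [mul_le_mul_of_nonneg_right hCP n3, mul_le_mul_of_nonneg_right hCP n5, mul_le_mul_of_nonneg_right hCP n6,
      mul_le_mul_of_nonneg_right hCP g1]
  have step1 : c' * (mixedRoughCount ρ ρ₁ ε₁ θ ε g r y : ℝ) ≤ c * interfaceCubicCount ρ ε g r y + c' * offCount σ₁ σ₂ y := by
    have h1 := mul_le_mul_of_nonneg_left ha hc'0.le
    have h2 : c' * K * (interfaceCubicCount ρ ε g r y : ℝ) ≤ c * interfaceCubicCount ρ ε g r y := mul_le_mul_of_nonneg_right hc'c n1
    linarith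
  linarith [mul_nonneg hc'0.le n3, mul_nonneg hc'0.le n6, mul_nonneg hc'0.le g1]

/-- **HI ⇒ PM** (tame), `0 ≤ r`. [this file] -/
theorem tameBalancedMixedRoughGap_of_interfaceCubicGap {ρ ρ₁ ε₁ θ ε g r : ℝ} (hr0 : 0 ≤ r) (h : TameBalancedInterfaceCubicGap ρ ε g r) :
    TameBalancedMixedRoughGap ρ ρ₁ ε₁ θ ε g r :=
  fun δ hδ hδ2 => balancedMixedRoughGapW_of_interfaceCubicGapW hr0 hδ hδ2 (h δ hδ hδ2)

/-- **FF_W ⇒ KF_W**: the explicit rate `e(fcc a, a√(2/3)) − e⋆` is a legitimate `c > 0` BY THE CERTIFIED CUSHION (`fccRate_pos`). [this file] -/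
theorem balancedFccBallGapW_of_fccFloorW {ρ ε g r σ₁ σ₂ : ℝ} (h : FccFloorW ρ ε g r σ₁ σ₂) : BalancedFccBallGapW ρ ε g r σ₁ σ₂ := by
  obtain ⟨a, hgt, ha, hh, hha, C, h⟩ := h
  exact ⟨_, C, fccRate_pos ha hh hha, h⟩

/-- **FF ⇒ KF** (tame); in particular `FccFloor ⇒ CubicCushion`. [this file] -/
theorem tameBalancedFccBallGap_of_fccFloor {ρ ε g r : ℝ} (h : TameFccFloor ρ ε g r) : TameBalancedFccBallGap ρ ε g r :=
  fun δ hδ hδ2 => balancedFccBallGapW_of_fccFloorW (h δ hδ hδ2)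

/-- `cubicCushion_of_fccFloor` (docstring added by the landing lane; see the module docstring). [formal bookkeeping] -/
theorem cubicCushion_of_fccFloor (h : FccFloor) : CubicCushion :=
  tameBalancedFccBallGap_of_fccFloor h

/-- **KF_W ∧ HI_W ⇒ HD_W(ρ)** for `0 ≤ r`: excluded middle on hexagonal proximity (`cubicCount_le_fccBall_add_interfaceCubic`) glued by g41's
`convexComb_core` BY NAME (KF the fine leaf, HI the coarse leaf; identical rebates). [this file] -/
theorem balancedCubicGapW_of_fccBall_interface {ρ ε g r σ₁ σ₂ : ℝ} (hr0 : 0 ≤ r)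
    (hF : BalancedFccBallGapW ρ ε g r σ₁ σ₂) (hI : BalancedInterfaceCubicGapW ρ ε g r σ₁ σ₂) : BalancedCubicGapW ρ ε g σ₁ σ₂ := by
  obtain ⟨c₁, C₁, hc₁, h₁⟩ := hF
  obtain ⟨c₂, C₂, hc₂, h₂⟩ := hI
  have hP₁0 : 0 ≤ max C₁ 0 := le_max_right _ _
  have hK : 0 < max C₁ 0 + c₂ + 1 := by linarith
  set t : ℝ := c₂ / (4 * (max C₁ 0 + c₂ + 1)) with ht
  have ht0 : 0 < t := by rw [ht]; positivity
  have ht4 : t ≤ 1 / 4 := by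
    rw [ht, div_le_iff₀ (by positivity)]
    nlinarith
  have htP : t * max C₁ 0 ≤ c₂ / 4 := by
    rw [ht, div_mul_eq_mul_div, div_le_iff₀ (by positivity)]
    nlinarith [mul_nonneg hc₂.le hP₁0, mul_nonneg hc₂.le hc₂.le]
  set m : ℝ := min (t * c₁) (c₂ / 4) with hm
  have hm0 : 0 < m := lt_min (mul_pos ht0 hc₁) (by positivity)
  refine ⟨m, max C₁ 0 + max C₂ 0, hm0, fun N y hy => ?_⟩
  obtain ⟨u₁, hu₁, H₁⟩ := h₁ N y hy
  obtain ⟨u₂, hu₂, H₂⟩ := h₂ N y hy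
  have hRc : (cubicCount ρ ε g y : ℝ) ≤ fccBallCount ρ ε g r y + interfaceCubicCount ρ ε g r y := by
    exact_mod_cast cubicCount_le_fccBall_add_interfaceCubic hr0 y
  have hDc : (notDeepCount ρ ε g y : ℝ) ≤ notDeepCount ρ ε g y + interfaceCubicCount ρ ε g r y := by
    linarith [(Nat.cast_nonneg _ : (0 : ℝ) ≤ interfaceCubicCount ρ ε g r y)]
  have n1 : (0 : ℝ) ≤ fccBallCount ρ ε g r y := Nat.cast_nonneg _
  have n2 : (0 : ℝ) ≤ interfaceCubicCount ρ ε g r y := Nat.cast_nonneg _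
  have n3 : (0 : ℝ) ≤ notDeepCount ρ ε g y := Nat.cast_nonneg _
  have n5 : (0 : ℝ) ≤ offCount σ₁ σ₂ y := Nat.cast_nonneg _
  have n6 : (0 : ℝ) ≤ (N : ℝ) ^ (2 / 3 : ℝ) := Real.rpow_nonneg (Nat.cast_nonneg _) _
  have g1 : 0 ≤ dilGain y + shGain u₁ y := add_nonneg (dilGain_nonneg y) (shGain_nonneg _ y)
  have g2 : 0 ≤ dilGain y + shGain u₂ y := add_nonneg (dilGain_nonneg y) (shGain_nonneg _ y)
  rcases le_total (shGain u₁ y) (shGain u₂ y) with hle | hle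
  · refine ⟨u₂, hu₂, ?_⟩
    exact convexComb_core H₁ H₂ hRc hDc n1 n2 n3 n3 n5 n6 g1 g2 (by linarith) le_rfl hc₂ ht0 ht4 htP hm0.le
      (min_le_left _ _) (min_le_right _ _)
  · refine ⟨u₁, hu₁, ?_⟩
    exact convexComb_core H₁ H₂ hRc hDc n1 n2 n3 n3 n5 n6 g1 g2 le_rfl (by linarith) hc₂ ht0 ht4 htP hm0.le
      (min_le_left _ _) (min_le_right _ _)

/-- **DEPTH NORMAL FORM OF HD (PROVED; the lens-4 reduction «a minimal counterexample is defect-free out to any fixed radius»)**: pricing the cubic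
letters at depth `L` implies pricing them at depth `ρ`, for all `ρ, L ≥ 0` on a window `0 < σ₁ ≤ σ₂` — `#cubic(ρ) ≤ #cubic(L) + #¬L-deep` and the
`L`-shadow of the defects is count-charged to the `ρ`-rebate by g74's `notDeepCount_depth_le` BY NAME. [this file] -/
theorem balancedCubicGapW_of_depth {ρ L ε g σ₁ σ₂ : ℝ} (hρ : 0 ≤ ρ) (hL : 0 ≤ L) (hσ : 0 < σ₁) (hσσ : σ₁ ≤ σ₂)
    (h : BalancedCubicGapW L ε g σ₁ σ₂) : BalancedCubicGapW ρ ε g σ₁ σ₂ := by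
  obtain ⟨c, C, hc, h⟩ := h
  set K : ℝ := 27 / σ₁ ^ 3 * (2 * L * σ₂ + σ₁) ^ 3 with hK
  have hb : 0 ≤ 2 * L * σ₂ + σ₁ := by nlinarith [mul_nonneg hL (hσ.le.trans hσσ)]
  have hK0 : 0 ≤ K := by rw [hK]; exact mul_nonneg (div_nonneg (by norm_num) (pow_nonneg hσ.le 3)) (pow_nonneg hb 3)
  set P : ℝ := max C 0 with hP
  have hP0 : 0 ≤ P := le_max_right _ _
  have hCP : C ≤ P := le_max_left _ _
  refine ⟨c, (c + P) * (K + 1) + P, hc, fun N y hy => ?_⟩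
  obtain ⟨u, hu, e⟩ := h N y hy
  refine ⟨u, hu, ?_⟩
  have ha : (cubicCount ρ ε g y : ℝ) ≤ cubicCount L ε g y + notDeepCount L ε g y := by
    exact_mod_cast cubicCount_depth_le y
  have hd : (notDeepCount L ε g y : ℝ) ≤ K * notDeepCount ρ ε g y + offCount σ₁ σ₂ y := by
    rw [hK]; exact notDeepCount_depth_le hρ hL hσ hσσ hy
  have n1 : (0 : ℝ) ≤ cubicCount L ε g y := Nat.cast_nonneg _
  have n2 : (0 : ℝ) ≤ notDeepCount L ε g y := Nat.cast_nonneg _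
  have n3 : (0 : ℝ) ≤ notDeepCount ρ ε g y := Nat.cast_nonneg _
  have n5 : (0 : ℝ) ≤ offCount σ₁ σ₂ y := Nat.cast_nonneg _
  have n6 : (0 : ℝ) ≤ (N : ℝ) ^ (2 / 3 : ℝ) := Real.rpow_nonneg (Nat.cast_nonneg _) _
  have g1 : 0 ≤ dilGain y + shGain u y := add_nonneg (dilGain_nonneg y) (shGain_nonneg _ y)
  have e' : (N : ℝ) * (⨅ Q : PeriodicConfiguration 3, Q.energyPerParticle lennardJones) + c * (cubicCount L ε g y : ℝ)
      - P * (notDeepCount L ε g y : ℝ) - P * (offCount σ₁ σ₂ y : ℝ) - P * (N : ℝ) ^ (2 / 3 : ℝ) - P * (dilGain y + shGain u y)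
      ≤ interactionEnergy lennardJones y := by
    linarith [mul_le_mul_of_nonneg_right hCP n2, mul_le_mul_of_nonneg_right hCP n5, mul_le_mul_of_nonneg_right hCP n6,
      mul_le_mul_of_nonneg_right hCP g1]
  have hcP : 0 ≤ c + P := by linarith
  have step1 : c * (cubicCount ρ ε g y : ℝ) ≤ c * cubicCount L ε g y + c * notDeepCount L ε g y := by
    have := mul_le_mul_of_nonneg_left ha hc.le
    linarith
  have step2 : (c + P) * (notDeepCount L ε g y : ℝ) ≤ (c + P) * K * notDeepCount ρ ε g y + (c + P) * offCount σ₁ σ₂ y := by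
    have := mul_le_mul_of_nonneg_left hd hcP
    linarith
  linarith [mul_nonneg hcP n3, mul_nonneg hP0 n3, mul_nonneg (mul_nonneg hcP hK0) n5, mul_nonneg (mul_nonneg hcP hK0) n6,
    mul_nonneg hcP n6, mul_nonneg (mul_nonneg hcP hK0) g1, mul_nonneg hcP g1]

/-- **Depth normal form (tame)**: `TameBalancedCubicGap L ε g ⇒ TameBalancedCubicGap ρ ε g` for all `ρ, L ≥ 0` — HD at every depth is ONE statement
modulo the census constants. [this file] -/
theorem tameBalancedCubicGap_of_depth {ρ L ε g : ℝ} (hρ : 0 ≤ ρ) (hL : 0 ≤ L) (h : TameBalancedCubicGap L ε g) :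
    TameBalancedCubicGap ρ ε g :=
  fun δ hδ hδ2 => balancedCubicGapW_of_depth hρ hL hδ hδ2 (h δ hδ hδ2)

/-- **HD_W(ρc) ⇒ KF_W(ρ, r)** for `ρc ≤ ρ`, `0 ≤ r ≤ ρ` (`#fccBall ≤ #cubic(ρc)`, `#¬ρc-deep ≤ #¬ρ-deep`; `balancedW_mono_core`). [this file] -/
theorem balancedFccBallGapW_of_cubicGapW {ρ ρc ε g r σ₁ σ₂ : ℝ} (hρc : ρc ≤ ρ) (hr0 : 0 ≤ r) (hr : r ≤ ρ)
    (h : BalancedCubicGapW ρc ε g σ₁ σ₂) : BalancedFccBallGapW ρ ε g r σ₁ σ₂ := by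
  obtain ⟨c, C, hc, h⟩ := h
  refine ⟨c, max C 0, hc, fun N y hy => ?_⟩
  obtain ⟨u, hu, e⟩ := h N y hy
  refine ⟨u, hu, ?_⟩
  have hR : (fccBallCount ρ ε g r y : ℝ) ≤ cubicCount ρc ε g y := by
    exact_mod_cast fccBallCount_le_cubicCount hρc hr0 hr y
  have hX : (notDeepCount ρc ε g y : ℝ) ≤ notDeepCount ρ ε g y := by exact_mod_cast notDeepCount_mono hρc y
  exact balancedW_mono_core e hc.le hR hX (Nat.cast_nonneg _) (Nat.cast_nonneg _) (Real.rpow_nonneg (Nat.cast_nonneg _) _)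
    (add_nonneg (dilGain_nonneg y) (shGain_nonneg _ y))

/-- **HD_W(ρc) ⇒ HI_W(ρ, r)** for `1 ≤ r`, `0 ≤ ρc`, `r(ρc+1) ≤ ρ` (`#interfaceCubic ≤ #cubic(ρc)`, `#¬ρc-deep ≤ #¬ρ-deep`). [this file] -/
theorem balancedInterfaceCubicGapW_of_cubicGapW {ρ ρc ε g r σ₁ σ₂ : ℝ} (hr : 1 ≤ r) (hρc : 0 ≤ ρc) (hρ : r * (ρc + 1) ≤ ρ)
    (h : BalancedCubicGapW ρc ε g σ₁ σ₂) : BalancedInterfaceCubicGapW ρ ε g r σ₁ σ₂ := by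
  obtain ⟨c, C, hc, h⟩ := h
  have hρcρ : ρc ≤ ρ := by nlinarith
  refine ⟨c, max C 0, hc, fun N y hy => ?_⟩
  obtain ⟨u, hu, e⟩ := h N y hy
  refine ⟨u, hu, ?_⟩
  have hR : (interfaceCubicCount ρ ε g r y : ℝ) ≤ cubicCount ρc ε g y := by
    exact_mod_cast interfaceCubicCount_le_cubicCount hr hρc hρ y
  have hX : (notDeepCount ρc ε g y : ℝ) ≤ notDeepCount ρ ε g y := by exact_mod_cast notDeepCount_mono hρcρ y
  exact balancedW_mono_core e hc.le hR hX (Nat.cast_nonneg _) (Nat.cast_nonneg _) (Real.rpow_nonneg (Nat.cast_nonneg _) _)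
    (add_nonneg (dilGain_nonneg y) (shGain_nonneg _ y))

/-! ## §5  RECORD LEVEL (PROVED): HD ⟺ KF ∧ HI, MR ⟸ QH ∧ KF ∧ HI, and the slot-3 / RDEF cones BY NAME -/

/-- `HexagonalDominance ⇒ CubicCushion` (`ρc = 4 ≤ 64`, `r = 12 ≤ 64`). [this file] -/
theorem cubicCushion_of_hexagonalDominance (h : HexagonalDominance) : CubicCushion :=
  fun δ hδ hδ2 => balancedFccBallGapW_of_cubicGapW (by norm_num) (by norm_num) (by norm_num) (h δ hδ hδ2)

/-- `HexagonalDominance ⇒ InterfaceDominance` (`12·(4+1) = 60 ≤ 64`). [this file] -/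
theorem interfaceDominance_of_hexagonalDominance (h : HexagonalDominance) : InterfaceDominance :=
  fun δ hδ hδ2 => balancedInterfaceCubicGapW_of_cubicGapW (by norm_num) (by norm_num) (by norm_num) (h δ hδ hδ2)

/-- `CubicCushion ∧ InterfaceDominance ⇒ HexagonalDominance`: KF ∧ HI ⇒ HD at depth 64 (`balancedCubicGapW_of_fccBall_interface`), then depth `64 → 4`
by the depth normal form. [this file] -/
theorem hexagonalDominance_of_cubicCushion_interfaceDominance (hF : CubicCushion) (hI : InterfaceDominance) : HexagonalDominance :=
  tameBalancedCubicGap_of_depth (L := 64) (by norm_num) (by norm_num)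
    fun δ hδ hδ2 => balancedCubicGapW_of_fccBall_interface (by norm_num) (hF δ hδ hδ2) (hI δ hδ hδ2)

/-- **THE LOSSLESS SPLIT OF THE TRANSFER TARGET**: `HexagonalDominance ↔ CubicCushion ∧ InterfaceDominance`. [this file] -/
theorem hexagonalDominance_iff_cubicCushion_and_interfaceDominance : HexagonalDominance ↔ CubicCushion ∧ InterfaceDominance :=
  ⟨fun h => ⟨cubicCushion_of_hexagonalDominance h, interfaceDominance_of_hexagonalDominance h⟩,
    fun h => hexagonalDominance_of_cubicCushion_interfaceDominance h.1 h.2⟩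

/-- `CubicCushion ⇒ QC` at the record frame. [this file] -/
theorem fccRough_record_of_cubicCushion (h : CubicCushion) :
    TameBalancedFccRoughGap 64 12 (1 / 10 ^ 5) (1 / 25) (3 / 50) (1 / 450) 12 :=
  tameBalancedFccRoughGap_of_fccBallGap h

/-- `InterfaceDominance ⇒ PM` at the record frame. [this file] -/
theorem mixedRough_record_of_interfaceDominance (h : InterfaceDominance) :
    TameBalancedMixedRoughGap 64 12 (1 / 10 ^ 5) (1 / 25) (3 / 50) (1 / 450) 12 :=
  tameBalancedMixedRoughGap_of_interfaceCubicGap (by norm_num) h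

/-- **THE CUT OF RECORD (tame; the AND-node of this file)**: `QH ∧ KF ∧ HI ⇒ MR` — g75's `tameBalancedAffMidGap_of_letterCut` BY NAME with QC from KF and
PM from HI. [this file] -/
theorem tameBalancedAffMidGap_of_cushionCut {ρ ρ₁ ε₁ θ ε g r : ℝ} (hr0 : 0 ≤ r) (hQH : TameBalancedHexRoughGap ρ ρ₁ ε₁ θ ε g r)
    (hKF : TameBalancedFccBallGap ρ ε g r) (hHI : TameBalancedInterfaceCubicGap ρ ε g r) : TameBalancedAffMidGap ρ ρ₁ ε₁ θ ε g :=
  tameBalancedAffMidGap_of_letterCut hQH (tameBalancedFccRoughGap_of_fccBallGap hKF) (tameBalancedMixedRoughGap_of_interfaceCubicGap hr0 hHI)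

/-- MR of record from `QH ∧ CubicCushion ∧ InterfaceDominance`. [this file] -/
theorem affMid_record_of_cushionCut (hQH : TameBalancedHexRoughGap 64 12 (1 / 10 ^ 5) (1 / 25) (3 / 50) (1 / 450) 12)
    (hKF : CubicCushion) (hHI : InterfaceDominance) : TameBalancedAffMidGap 64 12 (1 / 10 ^ 5) (1 / 25) (3 / 50) (1 / 450) :=
  tameBalancedAffMidGap_of_cushionCut (by norm_num) hQH hKF hHI

/-- MR of record from `QH ∧ FccFloor ∧ InterfaceDominance` (the sharp cubic leaf). [this file] -/
theorem affMid_record_of_floorCut (hQH : TameBalancedHexRoughGap 64 12 (1 / 10 ^ 5) (1 / 25) (3 / 50) (1 / 450) 12)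
    (hFF : FccFloor) (hHI : InterfaceDominance) : TameBalancedAffMidGap 64 12 (1 / 10 ^ 5) (1 / 25) (3 / 50) (1 / 450) :=
  affMid_record_of_cushionCut hQH (cubicCushion_of_fccFloor hFF) hHI

/-- MR of record from `QH ∧ HexagonalDominance` (g75's dominance cone, re-derived through the split). [this file] -/
theorem affMid_record_of_dominance (hQH : TameBalancedHexRoughGap 64 12 (1 / 10 ^ 5) (1 / 25) (3 / 50) (1 / 450) 12)
    (hHD : HexagonalDominance) : TameBalancedAffMidGap 64 12 (1 / 10 ^ 5) (1 / 25) (3 / 50) (1 / 450) :=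
  affMid_record_of_cushionCut hQH (cubicCushion_of_hexagonalDominance hHD) (interfaceDominance_of_hexagonalDominance hHD)

/-- **Slot-3 cone of record through the CushionCut**: g74's `tbdsg_of_mesoCut_record` with MR supplied by `QH ∧ CubicCushion ∧ InterfaceDominance`. [this file] -/
theorem tbdsg_of_cushionCut_record
    (hQH : TameBalancedHexRoughGap 64 12 (1 / 10 ^ 5) (1 / 25) (3 / 50) (1 / 450) 12) (hKF : CubicCushion) (hHI : InterfaceDominance)
    (hK : ∃ μ₁ μR : ℝ, 0 < μ₁ ∧ 0 < μR ∧ OverbindingBudgetAffineNearCluster.PureMarginStabilityAt (3 / 2000) μ₁ μR 4)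
    (hA : AffineChartStraightening)
    (hE : OverbindingBudgetAffineNearCluster.NearLightSkeletonEquilibrium (3 / 2000) 4 6 (1 / 1000) 12 (1 / 25) (1 / 2000) 4 6 320 12)
    (hC : OverbindingBudgetAffineNearCluster.NearPricedCoreFloor (3 / 2000) 4 6 (1 / 1000) 12 (1 / 25) (1 / 2000) (1 / (4 * 10 ^ 7) / 4) 4 6 12)
    (hS : OverbindingBudgetAffineNearCluster.NearPricedShellFloor (3 / 2000) 4 6 (1 / 1000) 12 (1 / 25) (1 / 2000) (1 / (4 * 10 ^ 7) / 4) 4 6 12)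
    (hV : OverbindingBudgetAffineNearCluster.ForceContentVisible (3 / 2000) 4 6 (1 / 1000) 12 (1 / 25) (1 / 2000) 4 6)
    (hN : OverbindingBudgetAffineNearCluster.NearSecondOrderFloor (3 / 2000) 4 6 (1 / 1000) 12 (1 / 25) (1 / 2000) (1 / (4 * 10 ^ 7)))
    (hZ : OverbindingBudgetAffineLocalisation.FarAggregatePricing 12 (1 / 25) (1 / 2000) (1 / (2 * 10 ^ 7)))
    (hFR : FineNonAffinity 12 (1 / 10 ^ 5) (1 / 25)) :
    TameBalancedDeepScaleGap (122 / 125) 0 4 (3 / 50) (1 / 450) :=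
  tbdsg_of_mesoCut_record hK hA hE hC hS hV hN hZ (affMid_record_of_cushionCut hQH hKF hHI) hFR

/-- **RDEF cone of record through the CushionCut**: g74's `rdef_of_ceg_shape_mesoCut_record` with MR supplied by `QH ∧ CubicCushion ∧ InterfaceDominance`.
[this file] -/
theorem rdef_of_ceg_shape_cushionCut_record
    (hCEG : Summit.AtomisticToContinuum.Crystallization.Theses.PricedLinkCensus.ChargedEnergyGap)
    (hSh : OverbindingBudgetTwoShellShape.TwoShellShape (1 / 100) (3 / 50) (1 / 450))
    (hQH : TameBalancedHexRoughGap 64 12 (1 / 10 ^ 5) (1 / 25) (3 / 50) (1 / 450) 12) (hKF : CubicCushion) (hHI : InterfaceDominance)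
    (hK : ∃ μ₁ μR : ℝ, 0 < μ₁ ∧ 0 < μR ∧ OverbindingBudgetAffineNearCluster.PureMarginStabilityAt (3 / 2000) μ₁ μR 4)
    (hA : AffineChartStraightening)
    (hE : OverbindingBudgetAffineNearCluster.NearLightSkeletonEquilibrium (3 / 2000) 4 6 (1 / 1000) 12 (1 / 25) (1 / 2000) 4 6 320 12)
    (hC : OverbindingBudgetAffineNearCluster.NearPricedCoreFloor (3 / 2000) 4 6 (1 / 1000) 12 (1 / 25) (1 / 2000) (1 / (4 * 10 ^ 7) / 4) 4 6 12)
    (hS : OverbindingBudgetAffineNearCluster.NearPricedShellFloor (3 / 2000) 4 6 (1 / 1000) 12 (1 / 25) (1 / 2000) (1 / (4 * 10 ^ 7) / 4) 4 6 12)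
    (hV : OverbindingBudgetAffineNearCluster.ForceContentVisible (3 / 2000) 4 6 (1 / 1000) 12 (1 / 25) (1 / 2000) 4 6)
    (hN : OverbindingBudgetAffineNearCluster.NearSecondOrderFloor (3 / 2000) 4 6 (1 / 1000) 12 (1 / 25) (1 / 2000) (1 / (4 * 10 ^ 7)))
    (hZ : OverbindingBudgetAffineLocalisation.FarAggregatePricing 12 (1 / 25) (1 / 2000) (1 / (2 * 10 ^ 7)))
    (hFR : FineNonAffinity 12 (1 / 10 ^ 5) (1 / 25))
    (hT : OverbindingBudgetGradedBareness.CleanlessExcessT) (hR : OverbindingBudgetCoherentCut.CoherentResidual 10) :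
    Summit.AtomisticToContinuum.Crystallization.Theses.OverbindingBudget.RobustDefectLimitWindows :=
  rdef_of_ceg_shape_mesoCut_record hCEG hSh hK hA hE hC hS hV hN hZ (affMid_record_of_cushionCut hQH hKF hHI) hFR hT hR

/-! ## §6  THE DEPTH NORMAL FORM OF THE BLOCKER QH (PROVED): near-counterexamples of QH are registered out to ANY fixed radius -/

/-- Counting: `#hexRough(ρ) ≤ #hexRough(L) + #¬L-deep` (a `ρ`-deep pure-hexagonal-ball rough site is `L`-deep or not). [this file] -/
theorem hexRoughCount_depth_le {ρ L ρ₁ ε₁ θ ε g r : ℝ} (y : Fin N → E3) :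
    hexRoughCount ρ ρ₁ ε₁ θ ε g r y ≤ hexRoughCount L ρ₁ ε₁ θ ε g r y + notDeepCount L ε g y := by
  simp only [hexRoughCount, notDeepCount, Nat.card_eq_fintype_card, Fintype.card_subtype]
  calc (Finset.univ.filter fun i => (DeepReg ρ ε g y i ∧ ¬ AffDeepReg ρ₁ ε₁ θ g y i) ∧ ¬ CNear r ε g y i).card
      ≤ ((Finset.univ.filter fun i => (DeepReg L ε g y i ∧ ¬ AffDeepReg ρ₁ ε₁ θ g y i) ∧ ¬ CNear r ε g y i) ∪
          (Finset.univ.filter fun i => ¬ DeepReg L ε g y i)).card := by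
        apply Finset.card_le_card
        intro i hi
        rw [Finset.mem_filter] at hi
        rw [Finset.mem_union, Finset.mem_filter, Finset.mem_filter]
        by_cases hD : DeepReg L ε g y i
        · exact Or.inl ⟨hi.1, ⟨hD, hi.2.1.2⟩, hi.2.2⟩
        · exact Or.inr ⟨hi.1, hD⟩
    _ ≤ _ := Finset.card_union_le _ _

/-- Counting: `#cubicRough(L) ≤ #cubicRough(ρ)` for `ρ ≤ L` (the rebated cubic-proximate rough set only shrinks with depth). [this file] -/
theorem cubicRoughCount_anti_depth {ρ L ρ₁ ε₁ θ ε g r : ℝ} (h : ρ ≤ L) (y : Fin N → E3) :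
    cubicRoughCount L ρ₁ ε₁ θ ε g r y ≤ cubicRoughCount ρ ρ₁ ε₁ θ ε g r y := by
  simp only [cubicRoughCount, Nat.card_eq_fintype_card, Fintype.card_subtype]
  apply Finset.card_le_card
  intro i hi
  rw [Finset.mem_filter] at hi ⊢
  exact ⟨hi.1, ⟨deepReg_anti h hi.2.1.1, hi.2.1.2⟩, hi.2.2⟩

/-- **DEPTH NORMAL FORM OF QH (PROVED)**: `QH_W(L) ⇒ QH_W(ρ)` for `0 ≤ ρ ≤ L` on a window `0 < σ₁ ≤ σ₂` — to price pure-hexagonal-ball roughness at depth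
`ρ` it suffices to price it at sites registered out to radius `L·nn`, however large `L`: the `L`-shadow of the defects is count-charged to the `ρ`-rebate
(g74's `notDeepCount_depth_le` BY NAME) and the rebated cubic-proximate set only shrinks.  A minimal counterexample to QH is a locally PERFECT,
smoothly modulated hexagonal crystal (the extremisers named in the memo: frozen zone-boundary phonons at amplitude `ε_h`). [this file] -/
theorem balancedHexRoughGapW_of_depth {ρ L ρ₁ ε₁ θ ε g r σ₁ σ₂ : ℝ} (hρ : 0 ≤ ρ) (hρL : ρ ≤ L) (hσ : 0 < σ₁) (hσσ : σ₁ ≤ σ₂)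
    (h : BalancedHexRoughGapW L ρ₁ ε₁ θ ε g r σ₁ σ₂) : BalancedHexRoughGapW ρ ρ₁ ε₁ θ ε g r σ₁ σ₂ := by
  have hL : 0 ≤ L := hρ.trans hρL
  obtain ⟨c, C, hc, h⟩ := h
  set K : ℝ := 27 / σ₁ ^ 3 * (2 * L * σ₂ + σ₁) ^ 3 with hK
  have hb : 0 ≤ 2 * L * σ₂ + σ₁ := by nlinarith [mul_nonneg hL (hσ.le.trans hσσ)]
  have hK0 : 0 ≤ K := by rw [hK]; exact mul_nonneg (div_nonneg (by norm_num) (pow_nonneg hσ.le 3)) (pow_nonneg hb 3)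
  set P : ℝ := max C 0 with hP
  have hP0 : 0 ≤ P := le_max_right _ _
  have hCP : C ≤ P := le_max_left _ _
  refine ⟨c, (c + P) * (K + 1) + P, hc, fun N y hy => ?_⟩
  obtain ⟨u, hu, e⟩ := h N y hy
  refine ⟨u, hu, ?_⟩
  have ha : (hexRoughCount ρ ρ₁ ε₁ θ ε g r y : ℝ) ≤ hexRoughCount L ρ₁ ε₁ θ ε g r y + notDeepCount L ε g y := by
    exact_mod_cast hexRoughCount_depth_le y
  have hd : (notDeepCount L ε g y : ℝ) ≤ K * notDeepCount ρ ε g y + offCount σ₁ σ₂ y := by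
    rw [hK]; exact notDeepCount_depth_le hρ hL hσ hσσ hy
  have hq : (cubicRoughCount L ρ₁ ε₁ θ ε g r y : ℝ) ≤ cubicRoughCount ρ ρ₁ ε₁ θ ε g r y := by
    exact_mod_cast cubicRoughCount_anti_depth hρL y
  have hDL : (((notDeepCount L ε g y + cubicRoughCount L ρ₁ ε₁ θ ε g r y : ℕ) : ℝ))
      = notDeepCount L ε g y + cubicRoughCount L ρ₁ ε₁ θ ε g r y := by push_cast; ring
  have hDρ : (((notDeepCount ρ ε g y + cubicRoughCount ρ ρ₁ ε₁ θ ε g r y : ℕ) : ℝ))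
      = notDeepCount ρ ε g y + cubicRoughCount ρ ρ₁ ε₁ θ ε g r y := by push_cast; ring
  rw [hDL] at e
  rw [hDρ]
  have n1 : (0 : ℝ) ≤ hexRoughCount L ρ₁ ε₁ θ ε g r y := Nat.cast_nonneg _
  have n2 : (0 : ℝ) ≤ notDeepCount L ε g y := Nat.cast_nonneg _
  have n3 : (0 : ℝ) ≤ notDeepCount ρ ε g y := Nat.cast_nonneg _
  have n4 : (0 : ℝ) ≤ cubicRoughCount L ρ₁ ε₁ θ ε g r y := Nat.cast_nonneg _
  have n4' : (0 : ℝ) ≤ cubicRoughCount ρ ρ₁ ε₁ θ ε g r y := Nat.cast_nonneg _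
  have n5 : (0 : ℝ) ≤ offCount σ₁ σ₂ y := Nat.cast_nonneg _
  have n6 : (0 : ℝ) ≤ (N : ℝ) ^ (2 / 3 : ℝ) := Real.rpow_nonneg (Nat.cast_nonneg _) _
  have g1 : 0 ≤ dilGain y + shGain u y := add_nonneg (dilGain_nonneg y) (shGain_nonneg _ y)
  have e' : (N : ℝ) * (⨅ Q : PeriodicConfiguration 3, Q.energyPerParticle lennardJones) + c * (hexRoughCount L ρ₁ ε₁ θ ε g r y : ℝ)
      - P * (notDeepCount L ε g y + cubicRoughCount L ρ₁ ε₁ θ ε g r y : ℝ) - P * (offCount σ₁ σ₂ y : ℝ) - P * (N : ℝ) ^ (2 / 3 : ℝ)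
      - P * (dilGain y + shGain u y) ≤ interactionEnergy lennardJones y := by
    linarith [mul_le_mul_of_nonneg_right hCP (add_nonneg n2 n4), mul_le_mul_of_nonneg_right hCP n5, mul_le_mul_of_nonneg_right hCP n6,
      mul_le_mul_of_nonneg_right hCP g1]
  have hcP : 0 ≤ c + P := by linarith
  have step1 : c * (hexRoughCount ρ ρ₁ ε₁ θ ε g r y : ℝ) ≤ c * hexRoughCount L ρ₁ ε₁ θ ε g r y + c * notDeepCount L ε g y := by
    have := mul_le_mul_of_nonneg_left ha hc.le
    linarith
  have step2 : (c + P) * (notDeepCount L ε g y : ℝ) ≤ (c + P) * K * notDeepCount ρ ε g y + (c + P) * offCount σ₁ σ₂ y := by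
    have := mul_le_mul_of_nonneg_left hd hcP
    linarith
  have step3 : P * (cubicRoughCount L ρ₁ ε₁ θ ε g r y : ℝ) ≤ P * cubicRoughCount ρ ρ₁ ε₁ θ ε g r y := mul_le_mul_of_nonneg_left hq hP0
  linarith [mul_nonneg hcP n3, mul_nonneg hP0 n3, mul_nonneg (mul_nonneg hcP hK0) n5, mul_nonneg (mul_nonneg hcP hK0) n6,
    mul_nonneg hcP n6, mul_nonneg (mul_nonneg hcP hK0) g1, mul_nonneg hcP g1, mul_nonneg hcP n4', mul_nonneg (mul_nonneg hcP hK0) n4',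
    mul_nonneg hP0 n4', mul_nonneg hcP n5]

/-- **Depth normal form of QH (tame)**: `TameBalancedHexRoughGap L … r ⇒ TameBalancedHexRoughGap ρ … r` for `0 ≤ ρ ≤ L`. [this file] -/
theorem tameBalancedHexRoughGap_of_depth {ρ L ρ₁ ε₁ θ ε g r : ℝ} (hρ : 0 ≤ ρ) (hρL : ρ ≤ L) (h : TameBalancedHexRoughGap L ρ₁ ε₁ θ ε g r) :
    TameBalancedHexRoughGap ρ ρ₁ ε₁ θ ε g r :=
  fun δ hδ hδ2 => balancedHexRoughGapW_of_depth hρ hρL hδ hδ2 (h δ hδ hδ2)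

end Summit.AtomisticToContinuum.Crystallization.Theorems.OverbindingBudgetAffineCushionCut
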